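import Summits.CriticalPhenomena.SAWScalingLimit.Theorems.SAWDefectDecoherenceBoundaryClosureRPolygonLimitDataMesh
import Summits.CriticalPhenomena.SAWScalingLimit.Theorems.SAWDefectDecoherenceBoundaryClosureRPolygonLimitDataEscape
import HarnessLib

/-!
# Polygon limit data, IV: eventual mass bounds on compacts off the root
(crux `BoundaryClosureR`, stmt-CriticalPhenomena-14004, line `polygon-parity-squeeze`, registered
stub `polygonLimitData` = piece C1 of the (A) assembly of `stub_polygonIdentification`)

For an exact-polygon admissible family pinned at the root `pt 0`, with the polygon `L¹` law on the
compacts of `closure Ω` off the root and boundary layer budgets off the root: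

* `massBound_midEdges` — for every compact `K ∌ pt 0`, eventually
  `δ² Σ_{z ∈ Ω(Λ_δ), δ mid z ∈ K} ‖F_{5/8}(z)‖ ≤ C_K ‖F_{5/8}(b_δ)‖` (the hypothesis of
  `LocalL1.pickEngine_weakStarLimit` on `U = ℂ ∖ {pt 0}`): the part of the window in `closure Ω` is the
  `L¹` law, the part off `closure Ω` is `PolygonLimitData.offClosure_mesh_le` after the budget cover
  `PolygonGreen.exists_budget_cover` with the exact polygon charts attached to the budget balls
  (off-closure edges hang at vertices of depth `< 16`: `PolygonLimitData.depth_lt_of_offClosure`);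
* `massBound_darts` — for every compact `K ∌ pt 0`, eventually
  `δ Σ_{e ∈ ∂Ω(Λ_δ), δ mid e ∈ K} Z(e) ≤ C_K Z(b_δ)` (the hypothesis of `sideMeasure_weakStarLimit`);
* `darts_eventually_avoid` — a compact set off `∂Ω` eventually contains no scaled dart midpoint
  (exhaustion inside, admissibility outside).
-/

noncomputable section

open scoped BigOperators Topology Classical
open Filter Set Metric
open Literature.Probability.LatticeModels Literature.Probability.RandomPlanarGeometry
open Literature.Probability.RandomPlanarGeometry.SAW
open Literature.Barriers.CriticalPhenomena.HexGreen (nbrs mem_nbrs_iff)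
open Summit.CriticalPhenomena.SAWScalingLimit.Theorems.PickHalfPlane
open Summit.CriticalPhenomena.SAWScalingLimit.Theorems.ObservableToSLE.FloorRatio (dist_smul_mesh)
open Summit.CriticalPhenomena.SAWScalingLimit.Theorems.DecoherenceSynthesis (norm_hexMidpoint_sub_hexCenter_le)
open Summit.CriticalPhenomena.SAWScalingLimit.Theorems.PolygonParitySqueeze.PolygonGreen

namespace Summit.CriticalPhenomena.SAWScalingLimit.Theorems.PolygonParitySqueeze.PolygonLimitData

/-! ### 1. Charts of an exact polygon family -/

/-- **Polygon charts at every boundary point.** In an exact polygon family, every `z ∈ ∂Ω` has a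
radius `s > 0` and a chart ball `B(z', R) ⊇ B(z, 2s)` (with room: `dist z z' + 2s ≤ R`) in which `Ω`
is a zigzag half-plane, the intersection, or the union of two of them through `z'`. [folklore] -/
theorem exists_chart {D : DobrushinDomain} {Λ : ℝ → Finset HexVertex} (hEP : ExactPolygonFamily D Λ) :
    ∀ z ∈ frontier D.carrier, ∃ s : ℝ, 0 < s ∧ ∃ (z' : ℂ) (R : ℝ) (k k' : Fin 6),
      dist z z' + 2 * s ≤ R ∧ (D.carrier ∩ ball z' R = halfPlane k z' ∩ ball z' R ∨
        D.carrier ∩ ball z' R = halfPlane k z' ∩ halfPlane k' z' ∩ ball z' R ∨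
        D.carrier ∩ ball z' R = (halfPlane k z' ∪ halfPlane k' z') ∩ ball z' R) := by
  obtain ⟨corners, rP, hrP, hcorF, -, hEPev⟩ := hEP
  obtain ⟨δ₀, hEP0⟩ := hEPev.exists
  intro z hz
  by_cases hfar : ∀ c ∈ corners, rP ≤ dist z c
  · obtain ⟨k, n, hset, -⟩ := (hEP0 z hz).1 hfar
    refine ⟨rP / 4, by positivity, z, rP / 2, k, k, ?_, Or.inl hset⟩
    rw [dist_self]; linarith
  · push Not at hfar
    obtain ⟨c, hc, hzc⟩ := hfar
    obtain ⟨k, k', n, n', hcases⟩ := (hEP0 c (hcorF hc)).2 hc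
    refine ⟨(rP - dist z c) / 2, by linarith, c, rP, k, k', by linarith, ?_⟩
    rcases hcases with ⟨hset, -⟩ | ⟨hset, -⟩
    · exact Or.inr (Or.inl hset)
    · exact Or.inr (Or.inr hset)

/-! ### 2. The `σ = 5/8` mass on compacts off the root -/

/-- **`L¹` mass of ALL mid-edges on compacts off the root.** For an exact-polygon admissible family
pinned at `pt 0`, the polygon `L¹` law on compacts of `closure Ω` off the root and boundary layer
budgets off the root give, for every compact `K ∌ pt 0`, a constant `C` with
`δ² Σ_{z ∈ Ω(Λ_δ), δ mid z ∈ K} ‖F_{5/8}(z)‖ ≤ C ‖F_{5/8}(b_δ)‖` eventually: the window splits into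
`δ mid z ∈ K ∩ closure Ω` (the `L¹` law) and `δ mid z ∈ K ∖ closure Ω` (`offClosure_mesh_le`).
[cite: DuminilCopinSmirnov2012, Conjecture 2 (normalised observable)] -/
theorem massBound_midEdges {D : DobrushinDomain} {ρ : ℝ} {Λ : ℝ → Finset HexVertex} {m : ℝ → ℤ}
    {b : ℝ → Sym2 HexVertex} (hAF : AdmissibleFamily D ρ Λ m b) (hEP : ExactPolygonFamily D Λ)
    {a : ℝ → Sym2 HexVertex} {r₀ : ℝ} {m₀ : ℝ → ℤ} (hPR : PinnedFlatRoot D Λ b (D.pt 0) a r₀ m₀)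
    (hL1 : ∀ K : Set ℂ, IsCompact K → K ⊆ closure D.carrier → D.pt 0 ∉ K → L1BoundOn Λ a b K)
    (hBL : ∀ z ∈ frontier D.carrier, z ≠ D.pt 0 → BoundaryLayerBudgetAt Λ a b z) :
    ∀ K : Set ℂ, IsCompact K → D.pt 0 ∉ K → ∃ C : ℝ, ∀ᶠ δ : ℝ in 𝓝[>] 0,
      δ ^ 2 * (∑ᶠ z ∈ {z : Sym2 HexVertex | z ∈ hexDomainMidEdges (Λ δ) ∧ (δ : ℂ) * hexMidpoint z ∈ K},
        ‖hexParafermionicObservable (Λ δ) (a δ) hexCriticalFugacity (5 / 8) z‖) ≤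
      C * ‖hexParafermionicObservable (Λ δ) (a δ) hexCriticalFugacity (5 / 8) (b δ)‖ := by
  intro K hK hK0
  obtain ⟨-, -, hadm, hexh, -⟩ := hAF
  obtain ⟨-, -, hroot, hat⟩ := hPR
  have hchartAt := exists_chart hEP
  ---------------------------------------------------------------- the cover (budgets + charts)
  obtain ⟨η₀, η₁, t, r, T, hη₀, hη₁, hfar, htP, hK'c, hK'Ω, hsplit⟩ := exists_budget_cover D.isOpen hK hK0
    (fun z s => (∃ rb C : ℝ, s ≤ rb ∧ ∀ᶠ δ : ℝ in 𝓝[>] 0, ∀ k : ℕ,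
      δ * (∑ᶠ v ∈ {v : HexVertex | v ∈ Λ δ ∧ (δ : ℂ) * hexCenter v ∈ ball z rb ∧ IsMetricDepth (Λ δ) v k},
        starMass (Λ δ) (a δ) v) ≤
      C * ((k : ℝ) + 1) ^ (3 / 4 : ℝ) * ‖hexParafermionicObservable (Λ δ) (a δ) hexCriticalFugacity 0 (b δ)‖) ∧
      ∃ (z' : ℂ) (R : ℝ) (k k' : Fin 6), dist z z' + 2 * s ≤ R ∧
        (D.carrier ∩ ball z' R = halfPlane k z' ∩ ball z' R ∨
          D.carrier ∩ ball z' R = halfPlane k z' ∩ halfPlane k' z' ∩ ball z' R ∨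
          D.carrier ∩ ball z' R = (halfPlane k z' ∪ halfPlane k' z') ∩ ball z' R))
    (fun z hz hzp => by
      obtain ⟨rb, C, hrb, h⟩ := hBL z hz hzp
      obtain ⟨s, hs, z', R, k, k', hR, hΩ⟩ := hchartAt z hz
      refine ⟨min rb s, lt_min hrb hs, ⟨rb, C, min_le_left _ _, h⟩, z', R, k, k', ?_, hΩ⟩
      linarith [min_le_right rb s])
  choose! rb Cb hrrb hCb using fun x (hx : x ∈ t) => (htP x hx).2.1
  have hchart : ∀ x ∈ t, ∃ (z' : ℂ) (R : ℝ) (k k' : Fin 6), dist x z' + 2 * r x ≤ R ∧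
      (D.carrier ∩ ball z' R = halfPlane k z' ∩ ball z' R ∨
        D.carrier ∩ ball z' R = halfPlane k z' ∩ halfPlane k' z' ∩ ball z' R ∨
        D.carrier ∩ ball z' R = (halfPlane k z' ∪ halfPlane k' z') ∩ ball z' R) :=
    fun x hx => (htP x hx).2.2
  set Cb' : ℂ → ℝ := fun x => max (Cb x) 0 with hCb'
  have hCb'0 : ∀ x ∈ t, 0 ≤ Cb' x := fun x _ => le_max_right _ _
  have hbudev := (t.eventually_all).2 hCb
  ---------------------------------------------------------------- the `L¹` law on `K ∩ closure Ω`
  set K₁ : Set ℂ := K ∩ closure D.carrier with hK₁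
  obtain ⟨C₁, hC₁⟩ := hL1 K₁ (hK.inter_right isClosed_closure) inter_subset_right (fun h => hK0 h.1)
  ---------------------------------------------------------------- bounded domain, exhaustion
  set K' : Set ℂ := cthickening η₁ T with hK'
  have hexhK := hexh K' hK'c hK'Ω
  obtain ⟨R₀, hR₀⟩ := (Metric.isBounded_iff_subset_closedBall 0).1 D.isBounded
  set Rd : ℝ := max (2 * R₀) 1 with hRd
  ---------------------------------------------------------------- eventual facts
  have hnormev := LocalL1.eventually_normaliser_ne_zero_of_bundles hadm hroot
  have hsmall : ∀ᶠ δ : ℝ in 𝓝[>] 0, δ < min (min η₀ η₁) 1 / 2 := by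
    have : Iio (min (min η₀ η₁) 1 / 2) ∈ 𝓝 (0 : ℝ) := Iio_mem_nhds (by positivity)
    exact mem_nhdsWithin_of_mem_nhds this
  have hδrev : ∀ᶠ δ : ℝ in 𝓝[>] 0, ∀ x ∈ t, 17 * δ ≤ r x := by
    refine (t.eventually_all).2 fun x hx => ?_
    have hrx : 0 < r x := (htP x hx).1
    have : Iio (r x / 17) ∈ 𝓝 (0 : ℝ) := Iio_mem_nhds (by positivity)
    filter_upwards [mem_nhdsWithin_of_mem_nhds this] with δ hδ
    have h := mem_Iio.1 hδ
    linarith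
  have hanear : ∀ᶠ δ : ℝ in 𝓝[>] 0, dist ((δ : ℂ) * hexMidpoint (a δ)) (D.pt 0) < η₀ :=
    Metric.tendsto_nhds.1 hat η₀ hη₀
  refine ⟨C₁ + 768 * ∑ x ∈ t, Cb' x, ?_⟩
  filter_upwards [self_mem_nhdsWithin, hsmall, hadm, hroot, hnormev, hbudev, hexhK, hanear, hC₁, hδrev]
    with δ hδ0 hδs hadmδ hrootδ hnormδ hbudδ hexhδ hanearδ hC₁δ hδrδ
  have hδ : 0 < δ := hδ0
  have hmin1 : min (min η₀ η₁) 1 ≤ η₀ := (min_le_left _ _).trans (min_le_left _ _)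
  have hmin2 : min (min η₀ η₁) 1 ≤ η₁ := (min_le_left _ _).trans (min_le_right _ _)
  have hmin3 : min (min η₀ η₁) 1 ≤ 1 := min_le_right _ _
  have hδη₀ : δ ≤ η₀ / 2 := by linarith
  have hδη₁ : δ ≤ η₁ := by linarith
  have hδ1 : δ ≤ 1 := by linarith
  obtain ⟨-, -, -, hcar, -⟩ := hadmδ
  obtain ⟨habd, -, -⟩ := hrootδ
  obtain ⟨haE, u, w, hauw, hw, hu⟩ := habd
  have huw : hexGraph.Adj u w := by rw [hauw] at haE; exact (SimpleGraph.mem_edgeSet hexGraph).1 haE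
  rw [hauw] at hnormδ hbudδ hC₁δ hanearδ
  rw [hauw]
  set Λδ := Λ δ with hΛδ
  set b' := b δ with hb'
  set F : Sym2 HexVertex → ℂ := hexParafermionicObservable Λδ s(u, w) hexCriticalFugacity (5 / 8) with hFdef
  set Z : Sym2 HexVertex → ℂ := hexParafermionicObservable Λδ s(u, w) hexCriticalFugacity 0 with hZdef
  obtain ⟨hFb0, hFbZ⟩ := hnormδ
  have hFbpos : 0 < ‖F b'‖ := norm_pos_iff.2 hFb0
  ---------------------------------------------------------------- depth bound
  have hΛnorm : ∀ y ∈ Λδ, ‖(δ : ℂ) * hexCenter y‖ ≤ R₀ := fun y hy =>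
    mem_closedBall_zero_iff.1 (hR₀ (hcar y hy))
  set Kd : ℕ := ⌊Rd / δ⌋₊ with hKd
  have hdepthK : ∀ v ∈ Λδ, ∀ k : ℕ, IsMetricDepth Λδ v k → k ≤ Kd := by
    intro v _ k hk
    have h1 := mul_le_of_isMetricDepth hδ.le hΛnorm hk
    have h2 : (k : ℝ) ≤ Rd / δ := by
      rw [le_div_iff₀ hδ]
      calc (k : ℝ) * δ = δ * k := mul_comm _ _
        _ ≤ 2 * R₀ := h1
        _ ≤ Rd := le_max_left _ _
    exact Nat.le_floor h2
  ---------------------------------------------------------------- budgets with non-negative constants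
  have hbudget : ∀ x ∈ t, ∀ k : ℕ, δ * (∑ᶠ v ∈ {v : HexVertex | v ∈ Λδ ∧
      (δ : ℂ) * hexCenter v ∈ ball x (rb x) ∧ IsMetricDepth Λδ v k}, starMass Λδ s(u, w) v) ≤
      Cb' x * ((k : ℝ) + 1) ^ (3 / 4 : ℝ) * ‖Z b'‖ :=
    fun x hx k => (hbudδ x hx k).trans (mul_le_mul_of_nonneg_right (mul_le_mul_of_nonneg_right
      (le_max_left _ _) (Real.rpow_nonneg (by positivity) _)) (norm_nonneg _))
  ---------------------------------------------------------------- cover data at mesh `δ`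
  have hTcl : ∀ v ∈ Λδ, (δ : ℂ) * hexCenter v ∈ T → ∀ t' : HexVertex, hexGraph.Adj v t' →
      (δ : ℂ) * hexMidpoint s(v, t') ∈ closure D.carrier := by
    intro v _ hvT t' hadj
    refine subset_closure (hK'Ω (mem_cthickening_of_dist_le _ _ _ _ hvT ?_))
    rw [dist_smul_mesh hδ.le, dist_eq_norm]
    exact (mul_le_mul_of_nonneg_left (norm_hexMidpoint_sub_hexCenter_le hadj) hδ.le).trans (by linarith)
  have hsplitδ : ∀ v ∈ Λδ, (δ : ℂ) * hexCenter v ∈ cthickening (δ / 2) K →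
      (∃ x ∈ t, (δ : ℂ) * hexCenter v ∈ ball x (r x)) ∨ (δ : ℂ) * hexCenter v ∈ T :=
    fun v hv hvS => hsplit _ (hcar v hv) (cthickening_mono (by linarith) _ hvS)
  have hroot0 : ∀ t' : HexVertex, hexGraph.Adj w t' → (δ : ℂ) * hexMidpoint s(w, t') ∉ K := by
    intro t' hwt
    refine hfar _ ?_
    have h1 : dist ((δ : ℂ) * hexMidpoint s(w, t')) ((δ : ℂ) * hexCenter w) ≤ δ / 2 := by
      rw [dist_smul_mesh hδ.le, dist_eq_norm]
      exact (mul_le_mul_of_nonneg_left (norm_hexMidpoint_sub_hexCenter_le hwt) hδ.le).trans (by linarith)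
    have h2 : dist ((δ : ℂ) * hexCenter w) ((δ : ℂ) * hexMidpoint s(u, w)) ≤ δ / 2 := by
      rw [dist_comm, dist_smul_mesh hδ.le, dist_eq_norm, Sym2.eq_swap]
      exact (mul_le_mul_of_nonneg_left (norm_hexMidpoint_sub_hexCenter_le huw.symm) hδ.le).trans (by linarith)
    linarith [dist_triangle4 ((δ : ℂ) * hexMidpoint s(w, t')) ((δ : ℂ) * hexCenter w)
      ((δ : ℂ) * hexMidpoint s(u, w)) (D.pt 0)]
  -- off-closure edges hang at vertices of depth `< 16` (exact polygon charts)
  have hdep : ∀ v ∈ Λδ, ∀ t' : HexVertex, hexGraph.Adj v t' → (δ : ℂ) * hexMidpoint s(v, t') ∈ K →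
      (δ : ℂ) * hexMidpoint s(v, t') ∉ closure D.carrier → ∀ j : ℕ, IsMetricDepth Λδ v j → j < 16 := by
    intro v hv t' hadj hS hcl j hj
    have hdist : dist ((δ : ℂ) * hexMidpoint s(v, t')) ((δ : ℂ) * hexCenter v) ≤ δ / 2 := by
      rw [dist_smul_mesh hδ.le, dist_eq_norm]
      exact (mul_le_mul_of_nonneg_left (norm_hexMidpoint_sub_hexCenter_le hadj) hδ.le).trans (by linarith)
    have hth : (δ : ℂ) * hexCenter v ∈ cthickening (δ / 2) K :=
      mem_cthickening_of_dist_le _ _ _ _ hS (by rw [dist_comm]; exact hdist)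
    obtain ⟨x, hx, hvx⟩ : ∃ x ∈ t, (δ : ℂ) * hexCenter v ∈ ball x (r x) := by
      rcases hsplitδ v hv hth with h | hT
      · exact h
      · exact absurd (hTcl v hv hT t' hadj) hcl
    obtain ⟨zc, R, k, k', hR, hΩ⟩ := hchart x hx
    have h17 := hδrδ x hx
    refine depth_lt_of_offClosure hΩ hδ hcar hdist ?_ hcl hj
    rw [mem_ball] at hvx ⊢
    have h3 := dist_triangle ((δ : ℂ) * hexMidpoint s(v, t')) ((δ : ℂ) * hexCenter v) zc
    have h4 := dist_triangle ((δ : ℂ) * hexCenter v) x zc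
    linarith
  ---------------------------------------------------------------- the two pieces of the window
  set A : Set (Sym2 HexVertex) := {z | z ∈ hexDomainMidEdges Λδ ∧ (δ : ℂ) * hexMidpoint z ∈ K} with hAdef
  set B : Set (Sym2 HexVertex) := {z | z ∈ hexDomainMidEdges Λδ ∧ (δ : ℂ) * hexMidpoint z ∈ K₁} with hBdef
  set Cw : Set (Sym2 HexVertex) := {z | z ∈ hexDomainMidEdges Λδ ∧
    ((δ : ℂ) * hexMidpoint z ∈ K ∧ (δ : ℂ) * hexMidpoint z ∉ closure D.carrier)} with hCwdef
  have hBf : B.Finite := GateMass.finite_midEdgeWindow Λδ _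
  have hCf : Cw.Finite := GateMass.finite_midEdgeWindow Λδ _
  have hAsub : A ⊆ B ∪ Cw := by
    rintro z ⟨hz, hzK⟩
    by_cases hcl : (δ : ℂ) * hexMidpoint z ∈ closure D.carrier
    · exact Or.inl ⟨hz, hzK, hcl⟩
    · exact Or.inr ⟨hz, hzK, hcl⟩
  have h1 : ∑ᶠ z ∈ A, ‖F z‖ ≤ (∑ᶠ z ∈ B, ‖F z‖) + ∑ᶠ z ∈ Cw, ‖F z‖ :=
    finsum_mem_le_add_of_subset_union hBf hCf hAsub fun z => norm_nonneg _
  have hoff := offClosure_mesh_le (Ω := D.carrier) (b := b') hu hδ hdepthK hCb'0 hrrb hbudget hdep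
    hTcl hsplitδ hroot0
  have hCbs : 0 ≤ ∑ x ∈ t, Cb' x := Finset.sum_nonneg hCb'0
  calc δ ^ 2 * ∑ᶠ z ∈ A, ‖F z‖ ≤ δ ^ 2 * ((∑ᶠ z ∈ B, ‖F z‖) + ∑ᶠ z ∈ Cw, ‖F z‖) :=
        mul_le_mul_of_nonneg_left h1 (sq_nonneg _)
    _ = δ ^ 2 * (∑ᶠ z ∈ B, ‖F z‖) + δ ^ 2 * ∑ᶠ z ∈ Cw, ‖F z‖ := mul_add _ _ _
    _ ≤ C₁ * ‖F b'‖ + 768 * (∑ x ∈ t, Cb' x) * δ * ‖Z b'‖ := add_le_add hC₁δ hoff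
    _ ≤ C₁ * ‖F b'‖ + 768 * (∑ x ∈ t, Cb' x) * 1 * ‖Z b'‖ := by gcongr
    _ = (C₁ + 768 * ∑ x ∈ t, Cb' x) * ‖F b'‖ := by rw [hFbZ]; ring

/-! ### 3. The `σ = 0` dart mass on compacts off the root -/

/-- **Dart mass on compacts off the root.** For an admissible family pinned at `pt 0` with boundary
layer budgets off the root and every compact `K ∌ pt 0`, a constant `C` with
`δ Σ_{e ∈ ∂Ω(Λ_δ), δ mid e ∈ K} Z(e) ≤ C Z(b_δ)` eventually (`dart_mesh_le` after the budget cover).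
[cite: DuminilCopinSmirnov2012, §2 (walks between mid-edges)] -/
theorem massBound_darts {D : DobrushinDomain} {ρ : ℝ} {Λ : ℝ → Finset HexVertex} {m : ℝ → ℤ}
    {b : ℝ → Sym2 HexVertex} (hAF : AdmissibleFamily D ρ Λ m b)
    {a : ℝ → Sym2 HexVertex} {r₀ : ℝ} {m₀ : ℝ → ℤ} (hPR : PinnedFlatRoot D Λ b (D.pt 0) a r₀ m₀)
    (hBL : ∀ z ∈ frontier D.carrier, z ≠ D.pt 0 → BoundaryLayerBudgetAt Λ a b z) :
    ∀ K : Set ℂ, IsCompact K → D.pt 0 ∉ K → ∃ C : ℝ, ∀ᶠ δ : ℝ in 𝓝[>] 0,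
      δ * (∑ᶠ e ∈ {e : Sym2 HexVertex | e ∈ hexDomainBoundary (Λ δ) ∧ (δ : ℂ) * hexMidpoint e ∈ K},
        ‖hexParafermionicObservable (Λ δ) (a δ) hexCriticalFugacity 0 e‖) ≤
      C * ‖hexParafermionicObservable (Λ δ) (a δ) hexCriticalFugacity 0 (b δ)‖ := by
  intro K hK hK0
  obtain ⟨-, -, hadm, hexh, -⟩ := hAF
  obtain ⟨-, -, hroot, hat⟩ := hPR
  ---------------------------------------------------------------- the cover
  obtain ⟨η₀, η₁, t, r, T, hη₀, hη₁, hfar, htP, hK'c, hK'Ω, hsplit⟩ := exists_budget_cover D.isOpen hK hK0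
    (fun z r => ∃ C : ℝ, ∀ᶠ δ : ℝ in 𝓝[>] 0, ∀ k : ℕ,
      δ * (∑ᶠ v ∈ {v : HexVertex | v ∈ Λ δ ∧ (δ : ℂ) * hexCenter v ∈ ball z r ∧ IsMetricDepth (Λ δ) v k},
        starMass (Λ δ) (a δ) v) ≤
      C * ((k : ℝ) + 1) ^ (3 / 4 : ℝ) * ‖hexParafermionicObservable (Λ δ) (a δ) hexCriticalFugacity 0 (b δ)‖)
    (fun z hz hzp => by obtain ⟨r, C, hr, h⟩ := hBL z hz hzp; exact ⟨r, hr, C, h⟩)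
  choose! Cb hCb using fun x (hx : x ∈ t) => (htP x hx).2
  set Cb' : ℂ → ℝ := fun x => max (Cb x) 0 with hCb'
  have hCb'0 : ∀ x ∈ t, 0 ≤ Cb' x := fun x _ => le_max_right _ _
  have hbudev := (t.eventually_all).2 hCb
  set K' : Set ℂ := cthickening η₁ T with hK'
  have hexhK := hexh K' hK'c hK'Ω
  obtain ⟨R₀, hR₀⟩ := (Metric.isBounded_iff_subset_closedBall 0).1 D.isBounded
  set Rd : ℝ := max (2 * R₀) 1 with hRd
  have hsmall : ∀ᶠ δ : ℝ in 𝓝[>] 0, δ < min (min η₀ η₁) 1 / 2 := by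
    have : Iio (min (min η₀ η₁) 1 / 2) ∈ 𝓝 (0 : ℝ) := Iio_mem_nhds (by positivity)
    exact mem_nhdsWithin_of_mem_nhds this
  have hanear : ∀ᶠ δ : ℝ in 𝓝[>] 0, dist ((δ : ℂ) * hexMidpoint (a δ)) (D.pt 0) < η₀ :=
    Metric.tendsto_nhds.1 hat η₀ hη₀
  refine ⟨3 * ∑ x ∈ t, Cb' x, ?_⟩
  filter_upwards [self_mem_nhdsWithin, hsmall, hadm, hroot, hbudev, hexhK, hanear]
    with δ hδ0 hδs hadmδ hrootδ hbudδ hexhδ hanearδ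
  have hδ : 0 < δ := hδ0
  have hmin1 : min (min η₀ η₁) 1 ≤ η₀ := (min_le_left _ _).trans (min_le_left _ _)
  have hmin2 : min (min η₀ η₁) 1 ≤ η₁ := (min_le_left _ _).trans (min_le_right _ _)
  have hδη₀ : δ ≤ η₀ / 2 := by linarith
  have hδη₁ : δ ≤ η₁ := by linarith
  obtain ⟨-, -, -, hcar, -⟩ := hadmδ
  obtain ⟨habd, -, -⟩ := hrootδ
  obtain ⟨haE, u, w, hauw, hw, hu⟩ := habd
  have huw : hexGraph.Adj u w := by rw [hauw] at haE; exact (SimpleGraph.mem_edgeSet hexGraph).1 haE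
  rw [hauw] at hbudδ hanearδ
  rw [hauw]
  set Λδ := Λ δ with hΛδ
  set b' := b δ with hb'
  set Z : Sym2 HexVertex → ℂ := hexParafermionicObservable Λδ s(u, w) hexCriticalFugacity 0 with hZdef
  ---------------------------------------------------------------- depth bound
  have hΛnorm : ∀ y ∈ Λδ, ‖(δ : ℂ) * hexCenter y‖ ≤ R₀ := fun y hy =>
    mem_closedBall_zero_iff.1 (hR₀ (hcar y hy))
  set Kd : ℕ := ⌊Rd / δ⌋₊ with hKd
  have hdepthK : ∀ v ∈ Λδ, ∀ k : ℕ, IsMetricDepth Λδ v k → k ≤ Kd := by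
    intro v _ k hk
    have h1 := mul_le_of_isMetricDepth hδ.le hΛnorm hk
    have h2 : (k : ℝ) ≤ Rd / δ := by
      rw [le_div_iff₀ hδ]
      calc (k : ℝ) * δ = δ * k := mul_comm _ _
        _ ≤ 2 * R₀ := h1
        _ ≤ Rd := le_max_left _ _
    exact Nat.le_floor h2
  have hbudget : ∀ x ∈ t, ∀ k : ℕ, δ * (∑ᶠ v ∈ {v : HexVertex | v ∈ Λδ ∧
      (δ : ℂ) * hexCenter v ∈ ball x (r x) ∧ IsMetricDepth Λδ v k}, starMass Λδ s(u, w) v) ≤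
      Cb' x * ((k : ℝ) + 1) ^ (3 / 4 : ℝ) * ‖Z b'‖ :=
    fun x hx k => (hbudδ x hx k).trans (mul_le_mul_of_nonneg_right (mul_le_mul_of_nonneg_right
      (le_max_left _ _) (Real.rpow_nonneg (by positivity) _)) (norm_nonneg _))
  ---------------------------------------------------------------- cover data at mesh `δ`
  have hdeep : ∀ v ∈ Λδ, (δ : ℂ) * hexCenter v ∈ T → ∀ y : HexVertex,
      dist (hexCenter y) (hexCenter v) ≤ 1 → y ∈ Λδ := by
    intro v _ hvT y hy
    refine hexhδ y (mem_cthickening_of_dist_le _ _ _ _ hvT ?_)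
    rw [dist_smul_mesh hδ.le]
    calc δ * dist (hexCenter y) (hexCenter v) ≤ δ * 1 := mul_le_mul_of_nonneg_left hy hδ.le
      _ ≤ η₁ := by linarith
  have hsplitδ : ∀ v ∈ Λδ, (δ : ℂ) * hexCenter v ∈ cthickening (δ / 2) K →
      (∃ x ∈ t, (δ : ℂ) * hexCenter v ∈ ball x (r x)) ∨ (δ : ℂ) * hexCenter v ∈ T :=
    fun v hv hvS => hsplit _ (hcar v hv) (cthickening_mono (by linarith) _ hvS)
  have hroot0 : ∀ t' : HexVertex, hexGraph.Adj w t' → (δ : ℂ) * hexMidpoint s(w, t') ∉ K := by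
    intro t' hwt
    refine hfar _ ?_
    have h1 : dist ((δ : ℂ) * hexMidpoint s(w, t')) ((δ : ℂ) * hexCenter w) ≤ δ / 2 := by
      rw [dist_smul_mesh hδ.le, dist_eq_norm]
      exact (mul_le_mul_of_nonneg_left (norm_hexMidpoint_sub_hexCenter_le hwt) hδ.le).trans (by linarith)
    have h2 : dist ((δ : ℂ) * hexCenter w) ((δ : ℂ) * hexMidpoint s(u, w)) ≤ δ / 2 := by
      rw [dist_comm, dist_smul_mesh hδ.le, dist_eq_norm, Sym2.eq_swap]
      exact (mul_le_mul_of_nonneg_left (norm_hexMidpoint_sub_hexCenter_le huw.symm) hδ.le).trans (by linarith)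
    linarith [dist_triangle4 ((δ : ℂ) * hexMidpoint s(w, t')) ((δ : ℂ) * hexCenter w)
      ((δ : ℂ) * hexMidpoint s(u, w)) (D.pt 0)]
  exact dart_mesh_le (b := b') hu hδ hdepthK hbudget hdeep hsplitδ hroot0

/-! ### 4. Darts avoid compacts off the boundary -/

/-- **Darts avoid compacts off `∂Ω`.** For an admissible family and a compact `K` disjoint from
`frontier Ω`, eventually no boundary dart of `Λ_δ` has its scaled midpoint in `K`: inside `Ω`
(exhaustion) the outer endpoint would lie in `Λ_δ`, outside `closure Ω` (admissibility) the inner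
endpoint would have its centre off `Ω`. [cite: DuminilCopinSmirnov2012, §2 (domains)] -/
theorem darts_eventually_avoid {D : DobrushinDomain} {ρ : ℝ} {Λ : ℝ → Finset HexVertex} {m : ℝ → ℤ}
    {b : ℝ → Sym2 HexVertex} (hAF : AdmissibleFamily D ρ Λ m b) {K : Set ℂ} (hK : IsCompact K)
    (hKf : K ⊆ (frontier D.carrier)ᶜ) :
    ∀ᶠ δ : ℝ in 𝓝[>] 0, ∀ e ∈ hexDomainBoundary (Λ δ), (δ : ℂ) * hexMidpoint e ∉ K := by
  obtain ⟨-, -, hadm, hexh, -⟩ := hAF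
  have hfr : frontier D.carrier = closure D.carrier \ D.carrier := D.isOpen.frontier_eq
  -- the two compact pieces of `K`
  set K₁ : Set ℂ := K ∩ closure D.carrier with hK₁
  set K₂ : Set ℂ := K ∩ (D.carrier)ᶜ with hK₂
  have hK₁c : IsCompact K₁ := hK.inter_right isClosed_closure
  have hK₂c : IsCompact K₂ := hK.inter_right D.isOpen.isClosed_compl
  have hK₁D : K₁ ⊆ D.carrier := by
    rintro z ⟨hzK, hzcl⟩
    by_contra h
    exact hKf hzK (by rw [hfr]; exact ⟨hzcl, h⟩)
  have hK₂D : K₂ ⊆ (closure D.carrier)ᶜ := by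
    rintro z ⟨hzK, hzD⟩ hzcl
    exact hKf hzK (by rw [hfr]; exact ⟨hzcl, hzD⟩)
  obtain ⟨τ₁, hτ₁, hτ₁D⟩ := hK₁c.exists_cthickening_subset_open D.isOpen hK₁D
  obtain ⟨τ₂, hτ₂, hτ₂D⟩ := hK₂c.exists_cthickening_subset_open isClosed_closure.isOpen_compl hK₂D
  have hexhK := hexh (cthickening τ₁ K₁) hK₁c.cthickening hτ₁D
  have hsmall : ∀ᶠ δ : ℝ in 𝓝[>] 0, δ < min τ₁ τ₂ := by
    have : Iio (min τ₁ τ₂) ∈ 𝓝 (0 : ℝ) := Iio_mem_nhds (lt_min hτ₁ hτ₂)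
    exact mem_nhdsWithin_of_mem_nhds this
  filter_upwards [self_mem_nhdsWithin, hsmall, hadm, hexhK] with δ hδ0 hδs hadmδ hexhδ
  have hδ : 0 < δ := hδ0
  have hδ1 : δ ≤ τ₁ := by linarith [min_le_left τ₁ τ₂]
  have hδ2 : δ ≤ τ₂ := by linarith [min_le_right τ₁ τ₂]
  obtain ⟨-, -, -, hcar, -⟩ := hadmδ
  rintro e ⟨he, x, y, rfl, hy, hx⟩ heK
  have hadj : hexGraph.Adj x y := (SimpleGraph.mem_edgeSet hexGraph).1 he
  have hdx : dist ((δ : ℂ) * hexMidpoint s(x, y)) ((δ : ℂ) * hexCenter x) ≤ δ / 2 := by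
    rw [dist_smul_mesh hδ.le, dist_eq_norm]
    exact (mul_le_mul_of_nonneg_left (norm_hexMidpoint_sub_hexCenter_le hadj) hδ.le).trans (by linarith)
  have hdy : dist ((δ : ℂ) * hexMidpoint s(x, y)) ((δ : ℂ) * hexCenter y) ≤ δ / 2 := by
    rw [dist_smul_mesh hδ.le, dist_eq_norm, Sym2.eq_swap]
    exact (mul_le_mul_of_nonneg_left (norm_hexMidpoint_sub_hexCenter_le hadj.symm) hδ.le).trans (by linarith)
  by_cases hcl : (δ : ℂ) * hexMidpoint s(x, y) ∈ closure D.carrier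
  · -- inside: the outer endpoint `x` would be in `Λ δ`
    refine hx (hexhδ x (mem_cthickening_of_dist_le _ _ _ _ (show _ ∈ K₁ from ⟨heK, hcl⟩) ?_))
    rw [dist_comm]; linarith
  · -- outside: the inner endpoint `y` would have its centre off `closure Ω`
    have hyK₂ : (δ : ℂ) * hexCenter y ∈ cthickening τ₂ K₂ := by
      refine mem_cthickening_of_dist_le _ _ _ _ (show _ ∈ K₂ from ⟨heK, fun h => hcl (subset_closure h)⟩) ?_
      rw [dist_comm]; linarith
    exact hτ₂D hyK₂ (subset_closure (hcar y hy))

/-! ### Registered form -/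

/-- **Registered helper `polygonLimitData_massBound`** (crux item stmt-CriticalPhenomena-14004, line
`polygon-parity-squeeze`, sub-goal of the stub `polygonLimitData`): registry form (one `∀`-term) of
`massBound_midEdges`. [cite: DuminilCopinSmirnov2012, Conjecture 2 (normalised observable)] -/
theorem polygonLimitData_massBound : ∀ (D : DobrushinDomain) (ρ : ℝ) (Λ : ℝ → Finset HexVertex) (m : ℝ → ℤ) (b : ℝ → Sym2 HexVertex), AdmissibleFamily D ρ Λ m b → ExactPolygonFamily D Λ → ∀ (a : ℝ → Sym2 HexVertex) (r₀ : ℝ) (m₀ : ℝ → ℤ), PinnedFlatRoot D Λ b (D.pt 0) a r₀ m₀ → (∀ K : Set ℂ, IsCompact K → K ⊆ closure D.carrier → D.pt 0 ∉ K → L1BoundOn Λ a b K) → (∀ z ∈ frontier D.carrier, z ≠ D.pt 0 → BoundaryLayerBudgetAt Λ a b z) → ∀ K : Set ℂ, IsCompact K → D.pt 0 ∉ K → ∃ C : ℝ, ∀ᶠ δ : ℝ in 𝓝[>] 0, δ ^ 2 * (∑ᶠ z ∈ {z : Sym2 HexVertex | z ∈ hexDomainMidEdges (Λ δ) ∧ (δ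 : ℂ) * hexMidpoint z ∈ K}, ‖hexParafermionicObservable (Λ δ) (a δ) hexCriticalFugacity (5 / 8) z‖) ≤ C * ‖hexParafermionicObservable (Λ δ) (a δ) hexCriticalFugacity (5 / 8) (b δ)‖ :=
  fun _ _ _ _ _ hAF hEP _ _ _ hPR hL1 hBL => massBound_midEdges hAF hEP hPR hL1 hBL

end Summit.CriticalPhenomena.SAWScalingLimit.Theorems.PolygonParitySqueeze.PolygonLimitData

end
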